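import Literature.Geometry.Lorentzian.KerrIngoingCoordRiemannLowered
import HarnessLib

/-!
# The Kerr metric in ingoing Kerr coordinates `(t*, r, μ, φ)`, VIII: the curvature endomorphisms

Infrastructure (all results proved), continuing `KerrIngoingCoordRiemannLowered*.lean`: the
**matrices of the curvature endomorphisms** `R(∂_A, ∂_C) = MetricCoord.riemAt (Kerr.Ingoing.bilin M
a) u ∂_A ∂_C` (`A < C`) on the coordinate basis, `R(∂_A,∂_C)∂_j = Σ_i R^i_{jAC} ∂_i` (O'Neill 1983,
Ch. 3, Lemma 3.38: `R^i_{jAC} = ∂_A Γ^i_{Cj} − ∂_C Γ^i_{Aj} + Γ^i_{Am}Γ^m_{Cj} − Γ^i_{Cm}Γ^m_{Aj}`),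
in closed form (rational in `r, μ`, denominators `Σ⁴`, `Σ³(1 − μ²)`, …), on the regular set `{Σ ≠ 0,
μ² ≠ 1}`: each component `(R ∂_j)ⁱ = Σ_d g^{id} g(R ∂_j, ∂_d)` (`Kerr.Ingoing.apply_eq_sum_ginvMat`)
is a short rational identity in the lowered components (`Kerr.Ingoing.rlow_*`), closed by
`field_simp`/`ring`. The closed forms were generated by computer algebra (exact rational arithmetic
over `ℚ(r, μ, M, a)`) and are checked here by Lean; nothing is taken on trust. Exponents are written
`^ (n : ℕ)` in the generated expressions: fixing the exponent type up front keeps their elaboration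
fast. This file: the pairs `(∂_0, ∂_1)`, `(∂_0, ∂_2)` (the six pairs `A < C` are spread over the
mutually independent `KerrIngoingCoordRiemann{,II,III}.lean`). The pairs `A > C`, `A = C` follow
from `MetricCoord.riemAt_swap`, `MetricCoord.riemAt_self`.

## References

* R. P. Kerr, Phys. Rev. Lett. 11 (1963) 237–238; R. P. Kerr, A. Schild, *A new class of vacuum
  solutions of the Einstein field equations* (1965), §3.
* B. O'Neill, *Semi-Riemannian geometry* (1983), Ch. 3, Prop. 3.13, Lemma 3.38, Prop. 3.36.
* M. Visser, *The Kerr spacetime: a brief introduction*, arXiv:0706.0622, (E:K1)–(E:K2).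
* R. C. Henry, *Kretschmann scalar for a Kerr–Newman black hole*, Astrophys. J. 535 (2000) 350.
-/

noncomputable section

set_option maxSynthPendingDepth 3

open Set Function Module
open scoped ContDiff Topology
open Literature.Geometry.Lorentzian.MetricCoord

namespace Literature.Geometry.Lorentzian

namespace Kerr

namespace Ingoing

variable (M a : ℝ) {u : E4}

/-- **The curvature endomorphism `R(∂_0, ∂_1)` of the Kerr metric in ingoing Kerr coordinates** on
the coordinate basis: `R(∂_0,∂_1)∂_j = Σ_i R^i_{j01} ∂_i` with the matrix `(R^i_{j01})_{ij}` below
(closed form; O'Neill 1983, Ch. 3, Lemma 3.38), on the regular set, obtained by raising the lowered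
components with `g⁻¹ = ginvMat` (`apply_eq_sum_ginvMat`). [cite: KerrSchild1965, §3] -/
theorem riem_01 (hu : u ∈ regularSet a) (j : Fin 4) :
    riemAt (bilin M a) u (E4.basisVector 0) (E4.basisVector 1) (E4.basisVector j) =
      ∑ i, (!![(-(12 * u 1 ^ (2 : ℕ) * u 2 ^ (2 : ℕ) * M ^ (2 : ℕ) * a ^ (2 : ℕ)) +
              4 * u 1 ^ (4 : ℕ) * M ^ (2 : ℕ)) / sigma a u ^ (4 : ℕ),
            (-(6 * u 1 * u 2 ^ (4 : ℕ) * M * a ^ (4 : ℕ)) -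
              12 * u 1 ^ (2 : ℕ) * u 2 ^ (2 : ℕ) * M ^ (2 : ℕ) * a ^ (2 : ℕ) -
              4 * u 1 ^ (3 : ℕ) * u 2 ^ (2 : ℕ) * M * a ^ (2 : ℕ) +
              4 * u 1 ^ (4 : ℕ) * M ^ (2 : ℕ) + 2 * u 1 ^ (5 : ℕ) * M) / sigma a u ^ (4 : ℕ),
            (-(3 * u 2 ^ (3 : ℕ) * M * a ^ (4 : ℕ)) +
              9 * u 1 ^ (2 : ℕ) * u 2 * M * a ^ (2 : ℕ)) / sigma a u ^ (3 : ℕ),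
            (3 * u 1 * u 2 ^ (6 : ℕ) * M * a ^ (5 : ℕ) -
              3 * u 1 * u 2 ^ (4 : ℕ) * M * a ^ (5 : ℕ) -
              12 * u 1 ^ (2 : ℕ) * u 2 ^ (4 : ℕ) * M ^ (2 : ℕ) * a ^ (3 : ℕ) +
              2 * u 1 ^ (3 : ℕ) * u 2 ^ (4 : ℕ) * M * a ^ (3 : ℕ) +
              12 * u 1 ^ (2 : ℕ) * u 2 ^ (2 : ℕ) * M ^ (2 : ℕ) * a ^ (3 : ℕ) -
              2 * u 1 ^ (3 : ℕ) * u 2 ^ (2 : ℕ) * M * a ^ (3 : ℕ) +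
              4 * u 1 ^ (4 : ℕ) * u 2 ^ (2 : ℕ) * M ^ (2 : ℕ) * a -
              u 1 ^ (5 : ℕ) * u 2 ^ (2 : ℕ) * M * a - 4 * u 1 ^ (4 : ℕ) * M ^ (2 : ℕ) * a +
              u 1 ^ (5 : ℕ) * M * a) / sigma a u ^ (4 : ℕ);
          (3 * u 1 * u 2 ^ (4 : ℕ) * M * a ^ (4 : ℕ) - 9 * u 1 * u 2 ^ (2 : ℕ) * M * a ^ (4 : ℕ) +
              12 * u 1 ^ (2 : ℕ) * u 2 ^ (2 : ℕ) * M ^ (2 : ℕ) * a ^ (2 : ℕ) -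
              7 * u 1 ^ (3 : ℕ) * u 2 ^ (2 : ℕ) * M * a ^ (2 : ℕ) +
              3 * u 1 ^ (3 : ℕ) * M * a ^ (2 : ℕ) - 4 * u 1 ^ (4 : ℕ) * M ^ (2 : ℕ) +
              2 * u 1 ^ (5 : ℕ) * M) / sigma a u ^ (4 : ℕ),
            (9 * u 1 * u 2 ^ (4 : ℕ) * M * a ^ (4 : ℕ) -
              9 * u 1 * u 2 ^ (2 : ℕ) * M * a ^ (4 : ℕ) +
              12 * u 1 ^ (2 : ℕ) * u 2 ^ (2 : ℕ) * M ^ (2 : ℕ) * a ^ (2 : ℕ) -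
              3 * u 1 ^ (3 : ℕ) * u 2 ^ (2 : ℕ) * M * a ^ (2 : ℕ) +
              3 * u 1 ^ (3 : ℕ) * M * a ^ (2 : ℕ) -
              4 * u 1 ^ (4 : ℕ) * M ^ (2 : ℕ)) / sigma a u ^ (4 : ℕ),
            (u 2 ^ (3 : ℕ) * M * a ^ (4 : ℕ) -
              3 * u 1 ^ (2 : ℕ) * u 2 * M * a ^ (2 : ℕ)) / sigma a u ^ (3 : ℕ),
            (-(9 * u 1 * u 2 ^ (4 : ℕ) * M * a ^ (5 : ℕ)) +
              12 * u 1 ^ (2 : ℕ) * u 2 ^ (4 : ℕ) * M ^ (2 : ℕ) * a ^ (3 : ℕ) -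
              9 * u 1 ^ (3 : ℕ) * u 2 ^ (4 : ℕ) * M * a ^ (3 : ℕ) +
              9 * u 1 * u 2 ^ (2 : ℕ) * M * a ^ (5 : ℕ) -
              12 * u 1 ^ (2 : ℕ) * u 2 ^ (2 : ℕ) * M ^ (2 : ℕ) * a ^ (3 : ℕ) +
              12 * u 1 ^ (3 : ℕ) * u 2 ^ (2 : ℕ) * M * a ^ (3 : ℕ) -
              4 * u 1 ^ (4 : ℕ) * u 2 ^ (2 : ℕ) * M ^ (2 : ℕ) * a +
              3 * u 1 ^ (5 : ℕ) * u 2 ^ (2 : ℕ) * M * a - 3 * u 1 ^ (3 : ℕ) * M * a ^ (3 : ℕ) +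
              4 * u 1 ^ (4 : ℕ) * M ^ (2 : ℕ) * a -
              3 * u 1 ^ (5 : ℕ) * M * a) / sigma a u ^ (4 : ℕ);
          (3 * u 2 ^ (5 : ℕ) * M * a ^ (4 : ℕ) - 3 * u 2 ^ (3 : ℕ) * M * a ^ (4 : ℕ) -
              9 * u 1 ^ (2 : ℕ) * u 2 ^ (3 : ℕ) * M * a ^ (2 : ℕ) +
              9 * u 1 ^ (2 : ℕ) * u 2 * M * a ^ (2 : ℕ)) / sigma a u ^ (4 : ℕ),
            (3 * u 2 ^ (5 : ℕ) * M * a ^ (4 : ℕ) - 3 * u 2 ^ (3 : ℕ) * M * a ^ (4 : ℕ) -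
              9 * u 1 ^ (2 : ℕ) * u 2 ^ (3 : ℕ) * M * a ^ (2 : ℕ) +
              9 * u 1 ^ (2 : ℕ) * u 2 * M * a ^ (2 : ℕ)) / sigma a u ^ (4 : ℕ),
            0,
            (u 2 ^ (7 : ℕ) * M * a ^ (5 : ℕ) - 4 * u 2 ^ (5 : ℕ) * M * a ^ (5 : ℕ) -
              5 * u 1 ^ (2 : ℕ) * u 2 ^ (5 : ℕ) * M * a ^ (3 : ℕ) +
              3 * u 2 ^ (3 : ℕ) * M * a ^ (5 : ℕ) +
              14 * u 1 ^ (2 : ℕ) * u 2 ^ (3 : ℕ) * M * a ^ (3 : ℕ) +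
              6 * u 1 ^ (4 : ℕ) * u 2 ^ (3 : ℕ) * M * a -
              9 * u 1 ^ (2 : ℕ) * u 2 * M * a ^ (3 : ℕ) -
              6 * u 1 ^ (4 : ℕ) * u 2 * M * a) / sigma a u ^ (4 : ℕ);
          (-(9 * u 1 * u 2 ^ (2 : ℕ) * M * a ^ (3 : ℕ)) +
              3 * u 1 ^ (3 : ℕ) * M * a) / sigma a u ^ (4 : ℕ),
            (-(9 * u 1 * u 2 ^ (2 : ℕ) * M * a ^ (3 : ℕ)) +
              3 * u 1 ^ (3 : ℕ) * M * a) / sigma a u ^ (4 : ℕ),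
            (-(2 * u 2 ^ (3 : ℕ) * M * a ^ (3 : ℕ)) +
              6 * u 1 ^ (2 : ℕ) * u 2 * M * a) / (sigma a u ^ (3 : ℕ) * sinSq u),
            (-(9 * u 1 * u 2 ^ (4 : ℕ) * M * a ^ (4 : ℕ)) +
              9 * u 1 * u 2 ^ (2 : ℕ) * M * a ^ (4 : ℕ) +
              3 * u 1 ^ (3 : ℕ) * u 2 ^ (2 : ℕ) * M * a ^ (2 : ℕ) -
              3 * u 1 ^ (3 : ℕ) * M * a ^ (2 : ℕ)) / sigma a u ^ (4 : ℕ)] : Matrix (Fin 4) (Fin 4)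
              ℝ) i j • E4.basisVector i := by
  have hS := hu.1
  have hP := hu.2
  refine (eq_sum_basisVector _).trans (Finset.sum_congr rfl fun i _ ↦ ?_)
  congr 1
  rw [apply_eq_sum_ginvMat M a hu]
  fin_cases j <;> fin_cases i <;> simp only [Fin.zero_eta, Fin.mk_one, Fin.reduceFinMk,
    Fin.isValue, Fin.sum_univ_four, ginvMat, Matrix.of_apply, Matrix.cons_val',
    Matrix.cons_val_zero, Matrix.cons_val_one, Matrix.cons_val, Matrix.empty_val',
    Matrix.cons_val_fin_one, rlow_01_01 M a hu, rlow_01_02 M a hu, rlow_01_03 M a hu,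
    rlow_01_12 M a hu, rlow_01_13 M a hu, rlow_01_23 M a hu, apply_riemAt_diag M a hu,
    apply_riemAt_bv_swap M a hu 0 1 1 0, apply_riemAt_bv_swap M a hu 0 1 2 0,
    apply_riemAt_bv_swap M a hu 0 1 3 0, apply_riemAt_bv_swap M a hu 0 1 2 1,
    apply_riemAt_bv_swap M a hu 0 1 3 1, apply_riemAt_bv_swap M a hu 0 1 3 2, h00, scalarH,
    mul_neg, neg_mul, neg_neg, mul_zero, zero_mul, add_zero, zero_add,
    neg_zero] <;> field_simp <;> simp only [sigma, sinSq] at hS hP ⊢ <;> ring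

/-- **The curvature endomorphism `R(∂_0, ∂_2)` of the Kerr metric in ingoing Kerr coordinates** on
the coordinate basis: `R(∂_0,∂_2)∂_j = Σ_i R^i_{j02} ∂_i` with the matrix `(R^i_{j02})_{ij}` below
(closed form; O'Neill 1983, Ch. 3, Lemma 3.38), on the regular set, obtained by raising the lowered
components with `g⁻¹ = ginvMat` (`apply_eq_sum_ginvMat`). [cite: KerrSchild1965, §3] -/
theorem riem_02 (hu : u ∈ regularSet a) (j : Fin 4) :
    riemAt (bilin M a) u (E4.basisVector 0) (E4.basisVector 2) (E4.basisVector j) =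
      ∑ i, (!![(-(6 * u 1 * u 2 ^ (3 : ℕ) * M ^ (2 : ℕ) * a ^ (4 : ℕ)) +
              18 * u 1 ^ (3 : ℕ) * u 2 * M ^ (2 : ℕ) * a ^ (2 : ℕ)) / sigma a u ^ (4 : ℕ),
            (-(3 * u 2 ^ (5 : ℕ) * M * a ^ (6 : ℕ)) -
              6 * u 1 * u 2 ^ (3 : ℕ) * M ^ (2 : ℕ) * a ^ (4 : ℕ) +
              6 * u 1 ^ (2 : ℕ) * u 2 ^ (3 : ℕ) * M * a ^ (4 : ℕ) +
              18 * u 1 ^ (3 : ℕ) * u 2 * M ^ (2 : ℕ) * a ^ (2 : ℕ) +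
              9 * u 1 ^ (4 : ℕ) * u 2 * M * a ^ (2 : ℕ)) / sigma a u ^ (4 : ℕ),
            (-(6 * u 1 * u 2 ^ (4 : ℕ) * M * a ^ (4 : ℕ)) +
              9 * u 1 * u 2 ^ (2 : ℕ) * M * a ^ (4 : ℕ) +
              5 * u 1 ^ (3 : ℕ) * u 2 ^ (2 : ℕ) * M * a ^ (2 : ℕ) -
              3 * u 1 ^ (3 : ℕ) * M * a ^ (2 : ℕ) -
              u 1 ^ (5 : ℕ) * M) / (sigma a u ^ (3 : ℕ) * sinSq u),
            (-(4 * u 1 * u 2 ^ (5 : ℕ) * M ^ (2 : ℕ) * a ^ (5 : ℕ)) +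
              6 * u 1 * u 2 ^ (3 : ℕ) * M ^ (2 : ℕ) * a ^ (5 : ℕ) +
              14 * u 1 ^ (3 : ℕ) * u 2 ^ (3 : ℕ) * M ^ (2 : ℕ) * a ^ (3 : ℕ) -
              18 * u 1 ^ (3 : ℕ) * u 2 * M ^ (2 : ℕ) * a ^ (3 : ℕ) -
              6 * u 1 ^ (5 : ℕ) * u 2 * M ^ (2 : ℕ) * a) / sigma a u ^ (4 : ℕ);
          (-(3 * u 2 ^ (3 : ℕ) * M * a ^ (6 : ℕ)) +
              6 * u 1 * u 2 ^ (3 : ℕ) * M ^ (2 : ℕ) * a ^ (4 : ℕ) -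
              3 * u 1 ^ (2 : ℕ) * u 2 ^ (3 : ℕ) * M * a ^ (4 : ℕ) +
              9 * u 1 ^ (2 : ℕ) * u 2 * M * a ^ (4 : ℕ) -
              18 * u 1 ^ (3 : ℕ) * u 2 * M ^ (2 : ℕ) * a ^ (2 : ℕ) +
              9 * u 1 ^ (4 : ℕ) * u 2 * M * a ^ (2 : ℕ)) / sigma a u ^ (4 : ℕ),
            (2 * u 2 ^ (5 : ℕ) * M * a ^ (6 : ℕ) - 3 * u 2 ^ (3 : ℕ) * M * a ^ (6 : ℕ) +
              6 * u 1 * u 2 ^ (3 : ℕ) * M ^ (2 : ℕ) * a ^ (4 : ℕ) -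
              7 * u 1 ^ (2 : ℕ) * u 2 ^ (3 : ℕ) * M * a ^ (4 : ℕ) +
              9 * u 1 ^ (2 : ℕ) * u 2 * M * a ^ (4 : ℕ) -
              18 * u 1 ^ (3 : ℕ) * u 2 * M ^ (2 : ℕ) * a ^ (2 : ℕ) +
              3 * u 1 ^ (4 : ℕ) * u 2 * M * a ^ (2 : ℕ)) / sigma a u ^ (4 : ℕ),
            0,
            (-(2 * u 2 ^ (5 : ℕ) * M * a ^ (7 : ℕ)) +
              4 * u 1 * u 2 ^ (5 : ℕ) * M ^ (2 : ℕ) * a ^ (5 : ℕ) -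
              2 * u 1 ^ (2 : ℕ) * u 2 ^ (5 : ℕ) * M * a ^ (5 : ℕ) +
              3 * u 2 ^ (3 : ℕ) * M * a ^ (7 : ℕ) -
              6 * u 1 * u 2 ^ (3 : ℕ) * M ^ (2 : ℕ) * a ^ (5 : ℕ) +
              10 * u 1 ^ (2 : ℕ) * u 2 ^ (3 : ℕ) * M * a ^ (5 : ℕ) -
              14 * u 1 ^ (3 : ℕ) * u 2 ^ (3 : ℕ) * M ^ (2 : ℕ) * a ^ (3 : ℕ) +
              7 * u 1 ^ (4 : ℕ) * u 2 ^ (3 : ℕ) * M * a ^ (3 : ℕ) -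
              9 * u 1 ^ (2 : ℕ) * u 2 * M * a ^ (5 : ℕ) +
              18 * u 1 ^ (3 : ℕ) * u 2 * M ^ (2 : ℕ) * a ^ (3 : ℕ) -
              12 * u 1 ^ (4 : ℕ) * u 2 * M * a ^ (3 : ℕ) +
              6 * u 1 ^ (5 : ℕ) * u 2 * M ^ (2 : ℕ) * a -
              3 * u 1 ^ (6 : ℕ) * u 2 * M * a) / sigma a u ^ (4 : ℕ);
          (-(6 * u 1 * u 2 ^ (4 : ℕ) * M * a ^ (4 : ℕ)) +
              9 * u 1 * u 2 ^ (2 : ℕ) * M * a ^ (4 : ℕ) -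
              6 * u 1 ^ (2 : ℕ) * u 2 ^ (2 : ℕ) * M ^ (2 : ℕ) * a ^ (2 : ℕ) +
              5 * u 1 ^ (3 : ℕ) * u 2 ^ (2 : ℕ) * M * a ^ (2 : ℕ) -
              3 * u 1 ^ (3 : ℕ) * M * a ^ (2 : ℕ) + 2 * u 1 ^ (4 : ℕ) * M ^ (2 : ℕ) -
              u 1 ^ (5 : ℕ) * M) / sigma a u ^ (4 : ℕ),
            (-(9 * u 1 * u 2 ^ (4 : ℕ) * M * a ^ (4 : ℕ)) +
              9 * u 1 * u 2 ^ (2 : ℕ) * M * a ^ (4 : ℕ) -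
              6 * u 1 ^ (2 : ℕ) * u 2 ^ (2 : ℕ) * M ^ (2 : ℕ) * a ^ (2 : ℕ) +
              3 * u 1 ^ (3 : ℕ) * u 2 ^ (2 : ℕ) * M * a ^ (2 : ℕ) -
              3 * u 1 ^ (3 : ℕ) * M * a ^ (2 : ℕ) +
              2 * u 1 ^ (4 : ℕ) * M ^ (2 : ℕ)) / sigma a u ^ (4 : ℕ),
            0,
            (9 * u 1 * u 2 ^ (4 : ℕ) * M * a ^ (5 : ℕ) -
              6 * u 1 ^ (2 : ℕ) * u 2 ^ (4 : ℕ) * M ^ (2 : ℕ) * a ^ (3 : ℕ) +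
              9 * u 1 ^ (3 : ℕ) * u 2 ^ (4 : ℕ) * M * a ^ (3 : ℕ) -
              9 * u 1 * u 2 ^ (2 : ℕ) * M * a ^ (5 : ℕ) +
              6 * u 1 ^ (2 : ℕ) * u 2 ^ (2 : ℕ) * M ^ (2 : ℕ) * a ^ (3 : ℕ) -
              12 * u 1 ^ (3 : ℕ) * u 2 ^ (2 : ℕ) * M * a ^ (3 : ℕ) +
              2 * u 1 ^ (4 : ℕ) * u 2 ^ (2 : ℕ) * M ^ (2 : ℕ) * a -
              3 * u 1 ^ (5 : ℕ) * u 2 ^ (2 : ℕ) * M * a + 3 * u 1 ^ (3 : ℕ) * M * a ^ (3 : ℕ) -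
              2 * u 1 ^ (4 : ℕ) * M ^ (2 : ℕ) * a +
              3 * u 1 ^ (5 : ℕ) * M * a) / sigma a u ^ (4 : ℕ);
          (-(3 * u 2 ^ (3 : ℕ) * M * a ^ (5 : ℕ)) +
              9 * u 1 ^ (2 : ℕ) * u 2 * M * a ^ (3 : ℕ)) / sigma a u ^ (4 : ℕ),
            (2 * u 2 ^ (5 : ℕ) * M * a ^ (5 : ℕ) - 3 * u 2 ^ (3 : ℕ) * M * a ^ (5 : ℕ) -
              7 * u 1 ^ (2 : ℕ) * u 2 ^ (3 : ℕ) * M * a ^ (3 : ℕ) +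
              9 * u 1 ^ (2 : ℕ) * u 2 * M * a ^ (3 : ℕ) +
              3 * u 1 ^ (4 : ℕ) * u 2 * M * a) / (sigma a u ^ (4 : ℕ) * sinSq u),
            (9 * u 1 * u 2 ^ (2 : ℕ) * M * a ^ (3 : ℕ) -
              3 * u 1 ^ (3 : ℕ) * M * a) / (sigma a u ^ (3 : ℕ) * sinSq u),
            (-(2 * u 2 ^ (5 : ℕ) * M * a ^ (6 : ℕ)) +
              3 * u 2 ^ (3 : ℕ) * M * a ^ (6 : ℕ) +
              7 * u 1 ^ (2 : ℕ) * u 2 ^ (3 : ℕ) * M * a ^ (4 : ℕ) -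
              9 * u 1 ^ (2 : ℕ) * u 2 * M * a ^ (4 : ℕ) -
              3 * u 1 ^ (4 : ℕ) * u 2 * M * a ^ (2 : ℕ)) / sigma a u ^ (4 : ℕ)] : Matrix (Fin 4)
              (Fin 4) ℝ) i j • E4.basisVector i := by
  have hS := hu.1
  have hP := hu.2
  refine (eq_sum_basisVector _).trans (Finset.sum_congr rfl fun i _ ↦ ?_)
  congr 1
  rw [apply_eq_sum_ginvMat M a hu]
  fin_cases j <;> fin_cases i <;> simp only [Fin.zero_eta, Fin.mk_one, Fin.reduceFinMk,
    Fin.isValue, Fin.sum_univ_four, ginvMat, Matrix.of_apply, Matrix.cons_val',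
    Matrix.cons_val_zero, Matrix.cons_val_one, Matrix.cons_val, Matrix.empty_val',
    Matrix.cons_val_fin_one, rlow_02_01 M a hu, rlow_02_02 M a hu, rlow_02_03 M a hu,
    rlow_02_12 M a hu, rlow_02_13 M a hu, rlow_02_23 M a hu, apply_riemAt_diag M a hu,
    apply_riemAt_bv_swap M a hu 0 2 1 0, apply_riemAt_bv_swap M a hu 0 2 2 0,
    apply_riemAt_bv_swap M a hu 0 2 3 0, apply_riemAt_bv_swap M a hu 0 2 2 1,
    apply_riemAt_bv_swap M a hu 0 2 3 1, apply_riemAt_bv_swap M a hu 0 2 3 2, h00, scalarH,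
    mul_neg, neg_mul, neg_neg, mul_zero, zero_mul, add_zero, zero_add,
    neg_zero] <;> field_simp <;> simp only [sigma, sinSq] at hS hP ⊢ <;> ring

end Ingoing

end Kerr

end Literature.Geometry.Lorentzian

end
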